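import Summits.AtomisticToContinuum.BoseEinsteinCondensation.Theses.BECStoquasticCensoring

/-!
# Crux `CellCondensationGrowing` (stmt-AtomisticToContinuum-14704) — `Lines/birth.lean`

BC3 birth skeleton for the rank-4 crux of route `BECStoquasticCensoring`
(sub-problem `BoseEinsteinCondensation`): LOCAL CONDENSATION AT LOGARITHMIC MESOSCALE — for every
repulsive finite-range `v`, constants `K₀, c, ρ₀` (before `ρ`), all `0 < ρ < ρ₀`, all large `N`, some
`δ > 0`, every `δ`-near-minimiser `Ψ` of the Dirichlet energy in the box of side `L = (N/ρ)^(1/3)`,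
every `K₀ ≤ K ≤ log N` and every interior cell `Q = x₀ + [0,ℓ)³`, `ℓ = K(ρa)^(-1/2)`:
`⟨u_Q, γ_Ψ u_Q⟩ ≥ c·ρℓ³` for the flat cell mode `u_Q = ℓ^(-3/2)·1_Q`.

## The line: CAPPED DYADIC CHAINING (interior-cell, poly-log truncation)

The crux sits between the printed N-INDEPENDENT condensation windows (LSSY2005 Thm 5.1,
Fournais2020 Thm 1.2, Junge2026 Cor. 6 — barrier `Literature.Barriers.AtomisticToContinuum.KineticGapLengthScales`)
and the thermodynamic target X_B1 (`K = (ρa)^(1/2)L/3`). The skeleton splits it along SCALE, not along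
the energy window:

* `stub_baseWindowCondensation` — the crux on every BOUNDED window of scales `K₀ ≤ K ≤ K₂`
  (`K₂` arbitrary but fixed before `ρ₀`; `c = c(v, K₂)`, `ρ₀ = ρ₀(v, K₂)`, uniform in `ρ < ρ₀`): interior-cell
  condensation of the thermodynamic Dirichlet near-minimiser at N-independent scales. Nearest print:
  Fournais2020 Thm 1.2 / Junge2026 Cor. 6 tie ONE periodic/Neumann box to its own density; here the
  cells are sub-cubes of the big box, so a local energy-equidistribution / local-surgery input for
  near-minimisers is needed on top of the kinetic-gap mechanism (LSSY2005 (5.15)–(5.17)). Size XL;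
  it is exactly the crux restricted to the regime the barrier does NOT forbid.
* `stub_dyadicPhaseLocking` — the NEW lever: one-step scale doubling for near-minimisers. If every
  interior cell of side `ℓ_K` carries flat-mode fraction `≥ f`, then every interior cell of side
  `ℓ_(2K) = 2ℓ_K` carries fraction `≥ η(K)·f`, for `K₁ ≤ K`, `2K ≤ log N`, with a loss factor whose
  product along every dyadic tower stays `≥ p > 0` (`p, K₁` before `ρ`; `η` after `ρ`). Since
  `u_Q = 8^(-1/2) Σ_e u_(Q_e)` over the eight sub-cells, `η(K)` is the phase-locking (relative
  coherence) factor of the eight sub-condensates of a `2ℓ_K`-cell; superfluid-stiffness heuristics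
  (route NUMBERS: stiffness `≍ (8π)^(-1/2)K²(ρa³)^(-1/2)`) give `1 − η(K) ≍ √(ρa³)/K²`, summable
  geometrically and uniform in small `ρ`. This is the interior-cell, log-capped analogue of
  `BECDyadicChaining.DyadicCoherenceDefect` / `BECHierarchicalRetention.GeometricRetention`, which bet
  on the same telescoping at FULL scale `L/2`; the cap `2K ≤ log N` keeps it strictly below X_B1.
* `cellCondensationGrowing_of_hyps : stub₁-sig → stub₂-sig → <crux body>` — REAL PROOF (no sorry), and
  `CellCondensationGrowing_of : CellCondensationGrowing := cellCondensationGrowing_of_hyps stub₁ stub₂`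
  (the crux BY NAME from the declared stubs): `K₀ := max K₀ K₁`, `c := p·c(2K₀)`,
  `ρ₀ := min`, `δ := min`; every `K ∈ [K₀, log N]` is bracketed as `K = 2^n K'`, `K' ∈ [K₀, 2K₀]`
  (`exists_nat_pow_near`), and the fraction is chained up the tower by induction on `n`
  (`dyadic_chain`, `Finset.prod_range_succ`), losing at most the factor `p`.

Why this is not shredding: neither stub is the crux — the base stops at a fixed scale window
(probe `stub → crux` fails: no induction engine), the step is a conditional one-scale inequality
(probe fails: no base) — and neither mentions `λ_max`/`HasGroundStateBEC` (probes `stub → BoseEinsteinCondensation`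
fail). Disproof used: none on file for this crux (`ledger crux ls`: no `Disproof.lean` yet);
negatives index (20 entries, 2026-08-17): only `BECPopovBerryRG.BerryStiffPhaseLRO` (n-dependent Villain
sandwich) and `BECSwapAffinity.SwapJensen` touch this sub-problem — neither is an instance of a stub.
Degenerate cases: `a = 0` (v a.e. zero) makes `ℓ = 0` and both stubs vacuous-true, exactly as for the
crux (refuter W.lean `ccgBody_zero`); `K ≤ 0` never occurs (`0 < K₀`, `0 < K₁`).
-/

namespace Summit.AtomisticToContinuum.BoseEinsteinCondensation.Cruxes.CellCondensationGrowing.Birth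

/-- STUB 1 (base of the tower; size XL, "fixed-window interior-cell condensation"). For every
repulsive finite-range `v` there is `K₀ > 0` such that for every finite upper scale `K₂ ≥ K₀` there are
`c, ρ₀ > 0` with: for `0 < ρ < ρ₀`, all large `N`, some `δ > 0`, every `δ`-near-minimiser `Ψ` of the
Dirichlet energy in the box of side `L = (N/ρ)^(1/3)`, every `K₀ ≤ K ≤ K₂` and every interior cell
`Q = x₀ + [0,ℓ)³`, `ℓ = K(ρa)^(-1/2)`: `⟨u_Q, γ_Ψ u_Q⟩ ≥ c·ρℓ³`. The crux restricted to N-INDEPENDENT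
scales — the regime of LSSY2005 Thm 5.1 / Fournais2020 Thm 1.2 / Junge2026 Cor. 6 (one box tied to its
own density), to be transported to interior sub-cubes of the thermodynamic Dirichlet near-minimiser
(local energy equidistribution + Neumann kinetic gap `π²/ℓ²` per cell, LSSY2005 (5.15)–(5.17)).
Why plausibly true: at fixed `K₂` and `ρ → 0` each cell holds `n̄ = K³(ρa³)^(-1/2) → ∞` particles with
Bogoliubov depletion `O(√(ρa³))`; `c = 1/2` is expected. -/
theorem stub_baseWindowCondensation :
    ∀ v : ℝ → ENNReal, Literature.MathematicalPhysics.QuantumManyBody.BoseGas.IsRepulsiveFiniteRange v → ∃ K₀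
      : ℝ, 0 < K₀ ∧ ∀ K₂ : ℝ, K₀ ≤ K₂ → ∃ c ρ₀ : ℝ, 0 < c ∧ 0 < ρ₀ ∧ ∀ ρ : ℝ, 0 < ρ → ρ < ρ₀ → ∀ᶠ N : ℕ in
      Filter.atTop, let a : ℝ := (Literature.MathematicalPhysics.QuantumManyBody.BoseGas.scatteringLength
      v).toReal; let L : ℝ := Literature.MathematicalPhysics.QuantumManyBody.BoseGas.sideLength ρ N; ∃ δ :
      ENNReal, 0 < δ ∧ ∀ Ψ : Literature.MathematicalPhysics.QuantumManyBody.BoseGas.TrialState N L,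
      Literature.MathematicalPhysics.QuantumManyBody.BoseGas.energy v Ψ ≤
      Literature.MathematicalPhysics.QuantumManyBody.BoseGas.groundStateEnergy v N L + δ → ∀ K : ℝ, K₀ ≤ K → K
      ≤ K₂ → let ℓ : ℝ := K * (ρ * a) ^ (-(1 / 2 : ℝ)); ∀ x₀ : EuclideanSpace ℝ (Fin 3), (∀ k, ℓ ≤ x₀ k ∧ x₀ k
      + 2 * ℓ ≤ L) → ENNReal.ofReal (c * ρ * ℓ ^ 3) ≤
      Literature.MathematicalPhysics.QuantumManyBody.BoseGas.occupation N ({x : EuclideanSpace ℝ (Fin 3) | ∀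
      k, x k ∈ Set.Ico (x₀ k) (x₀ k + ℓ)}.indicator fun _ => ((Real.sqrt (ℓ ^ 3))⁻¹ : ℂ)) Ψ.ψ := by
  sorry

/-- STUB 2 (the lever; size open — "dyadic phase locking of near-minimisers up to the logarithmic
cap"). For every repulsive finite-range `v` there are `K₁, ρ₁, p > 0` such that for `0 < ρ < ρ₁` there
is a loss factor `η : ℝ → ℝ`, `η ≥ 0` on `[K₁, ∞)`, whose products along every dyadic tower are bounded
below, `∏_(i<n) η(2^i K) ≥ p` for all `K ≥ K₁` and `n`, with: for all large `N`, some `δ > 0`, every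
`δ`-near-minimiser `Ψ` (box side `L = (N/ρ)^(1/3)`), every `K ≥ K₁` with `2K ≤ log N` and every
`f ≥ 0`: IF every interior cell of side `ℓ = K(ρa)^(-1/2)` has flat-mode occupation `≥ f·ρℓ³`, THEN
every interior cell of side `ℓ' = 2K(ρa)^(-1/2)` has flat-mode occupation `≥ η(K)·f·ρℓ'³`.
Mechanism: `u_(Q') = 8^(-1/2) Σ_e u_(Q_e)` over the eight sub-cells, so
`⟨u_(Q'), γ u_(Q')⟩ = (1/8) Σ_(e,e') ⟨u_(Q_e), γ u_(Q_e')⟩` and `η(K)` is the relative phase coherence of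
the eight sub-condensates; stiffness heuristics give `1 − η(K) ≍ √(ρa³)/K²` (summable, uniform in
small `ρ`), e.g. `η(K) = 1 − C/K²`, `p = 1 − 4C/(3K₁²)`. Log-capped, interior-cell analogue of
`BECDyadicChaining.DyadicCoherenceDefect`; strictly below X_B1 because `2K ≤ log N ≪ (ρa)^(1/2)L`.
Why it might fail: it is where `KineticGapLengthScales` bites — energy-window inputs alone give
`1 − η(K) ≍ K² ×` (relative energy precision), not `K^(-2)`; needs a ground-state-specific tool. -/
theorem stub_dyadicPhaseLocking :
    ∀ v : ℝ → ENNReal, Literature.MathematicalPhysics.QuantumManyBody.BoseGas.IsRepulsiveFiniteRange v → ∃ K₁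
      ρ₁ p : ℝ, 0 < K₁ ∧ 0 < ρ₁ ∧ 0 < p ∧ ∀ ρ : ℝ, 0 < ρ → ρ < ρ₁ → ∃ η : ℝ → ℝ, (∀ K : ℝ, K₁ ≤ K → 0 ≤ η K) ∧
      (∀ K : ℝ, K₁ ≤ K → ∀ n : ℕ, p ≤ (Finset.range n).prod (fun i => η (2 ^ i * K))) ∧ ∀ᶠ N : ℕ in
      Filter.atTop, let a : ℝ := (Literature.MathematicalPhysics.QuantumManyBody.BoseGas.scatteringLength
      v).toReal; let L : ℝ := Literature.MathematicalPhysics.QuantumManyBody.BoseGas.sideLength ρ N; ∃ δ :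
      ENNReal, 0 < δ ∧ ∀ Ψ : Literature.MathematicalPhysics.QuantumManyBody.BoseGas.TrialState N L,
      Literature.MathematicalPhysics.QuantumManyBody.BoseGas.energy v Ψ ≤
      Literature.MathematicalPhysics.QuantumManyBody.BoseGas.groundStateEnergy v N L + δ → ∀ K : ℝ, K₁ ≤ K → 2
      * K ≤ Real.log N → let ℓ : ℝ := K * (ρ * a) ^ (-(1 / 2 : ℝ)); let ℓ' : ℝ := 2 * K * (ρ * a) ^ (-(1 / 2 :
      ℝ)); ∀ f : ℝ, 0 ≤ f → (∀ x₀ : EuclideanSpace ℝ (Fin 3), (∀ k, ℓ ≤ x₀ k ∧ x₀ k + 2 * ℓ ≤ L) →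
      ENNReal.ofReal (f * ρ * ℓ ^ 3) ≤ Literature.MathematicalPhysics.QuantumManyBody.BoseGas.occupation N ({x
      : EuclideanSpace ℝ (Fin 3) | ∀ k, x k ∈ Set.Ico (x₀ k) (x₀ k + ℓ)}.indicator fun _ => ((Real.sqrt (ℓ ^
      3))⁻¹ : ℂ)) Ψ.ψ) → ∀ x₀ : EuclideanSpace ℝ (Fin 3), (∀ k, ℓ' ≤ x₀ k ∧ x₀ k + 2 * ℓ' ≤ L) →
      ENNReal.ofReal (η K * f * ρ * ℓ' ^ 3) ≤
      Literature.MathematicalPhysics.QuantumManyBody.BoseGas.occupation N ({x : EuclideanSpace ℝ (Fin 3) | ∀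
      k, x k ∈ Set.Ico (x₀ k) (x₀ k + ℓ')}.indicator fun _ => ((Real.sqrt (ℓ' ^ 3))⁻¹ : ℂ)) Ψ.ψ := by
  sorry

/-- ABSTRACT DYADIC CHAINING (real proof). A scale-indexed family of "fraction ≥ f" predicates that
is monotone in `f`, holds with fraction `c` on the fundamental window `[K₀, 2K₀]`, and propagates from
`K` to `2K` with loss factor `η K` while `2K ≤ Kmax`, holds with fraction `p·c` at every scale
`K₀ ≤ K ≤ Kmax`, provided the loss products along dyadic towers stay `≥ p`. Bracketing
`K = 2^n K'`, `K' ∈ [K₀, 2K₀]` by `exists_nat_pow_near`, then induction on `n`. [folklore] -/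
theorem dyadic_chain {P : ℝ → ℝ → Prop} {K₀ Kmax c p : ℝ} {η : ℝ → ℝ}
    (hK₀ : 0 < K₀) (hc : 0 ≤ c)
    (hmono : ∀ K f g, K₀ ≤ K → f ≤ g → P K g → P K f)
    (hbase : ∀ K, K₀ ≤ K → K ≤ 2 * K₀ → P K c)
    (hstep : ∀ K f, K₀ ≤ K → 2 * K ≤ Kmax → 0 ≤ f → P K f → P (2 * K) (η K * f))
    (hη : ∀ K, K₀ ≤ K → 0 ≤ η K)
    (hprod : ∀ K, K₀ ≤ K → ∀ n : ℕ, p ≤ (Finset.range n).prod (fun i => η (2 ^ i * K))) :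
    ∀ K, K₀ ≤ K → K ≤ Kmax → P K (p * c) := by
  -- (A) chain up a dyadic tower started in the fundamental window
  have tower : ∀ n : ℕ, ∀ K', K₀ ≤ K' → K' ≤ 2 * K₀ → 2 ^ n * K' ≤ Kmax →
      P (2 ^ n * K') ((Finset.range n).prod (fun i => η (2 ^ i * K')) * c) := by
    intro n
    induction n with
    | zero =>
      intro K' h1 h2 _
      simpa using hbase K' h1 h2
    | succ n ih =>
      intro K' h1 h2 h3
      have hK'pos : 0 < K' := hK₀.trans_le h1
      have hge : ∀ m : ℕ, K₀ ≤ 2 ^ m * K' := fun m =>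
        h1.trans (le_mul_of_one_le_left hK'pos.le (one_le_pow₀ (by norm_num)))
      have e1 : (2 : ℝ) * (2 ^ n * K') = 2 ^ (n + 1) * K' := by ring
      have h3' : 2 * (2 ^ n * K') ≤ Kmax := by rw [e1]; exact h3
      have h3'' : 2 ^ n * K' ≤ Kmax := by
        have h0 : 0 ≤ (2 : ℝ) ^ n * K' := mul_nonneg (pow_nonneg (by norm_num) n) hK'pos.le
        linarith
      have hf : 0 ≤ (Finset.range n).prod (fun i => η (2 ^ i * K')) * c :=
        mul_nonneg (Finset.prod_nonneg fun i _ => hη _ (hge i)) hc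
      have h := hstep (2 ^ n * K') _ (hge n) h3' hf (ih K' h1 h2 h3'')
      have e2 : η (2 ^ n * K') * ((Finset.range n).prod (fun i => η (2 ^ i * K')) * c) =
          (Finset.range (n + 1)).prod (fun i => η (2 ^ i * K')) * c := by
        rw [Finset.prod_range_succ]; ring
      rw [e1, e2] at h
      exact h
  -- (B) bracket an arbitrary scale K ∈ [K₀, Kmax] as 2^n K' with K' in the fundamental window
  intro K hK hKmax
  have hx : (1 : ℝ) ≤ K / K₀ := (one_le_div hK₀).2 hK
  obtain ⟨n, hn1, hn2⟩ := exists_nat_pow_near hx one_lt_two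
  have h2n : (0 : ℝ) < 2 ^ n := pow_pos (by norm_num) n
  have hKK' : 2 ^ n * (K / 2 ^ n) = K := by field_simp
  have h1 : K₀ ≤ K / 2 ^ n := by
    rw [le_div_iff₀ h2n]
    have h' : 2 ^ n * K₀ ≤ K := (le_div_iff₀ hK₀).1 hn1
    linarith
  have h2 : K / 2 ^ n ≤ 2 * K₀ := by
    rw [div_le_iff₀ h2n]
    have h' : K < 2 ^ (n + 1) * K₀ := (div_lt_iff₀ hK₀).1 hn2
    have e : (2 : ℝ) ^ (n + 1) * K₀ = 2 * K₀ * 2 ^ n := by ring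
    linarith
  have hA := tower n (K / 2 ^ n) h1 h2 (by rw [hKK']; exact hKmax)
  rw [hKK'] at hA
  exact hmono K _ _ hK (mul_le_mul_of_nonneg_right (hprod _ h1 n) hc) hA

/-- ASSEMBLY, HYPOTHESIS FORM (real proof, no `sorry`, axioms propext/Classical.choice/Quot.sound):
`stub_baseWindowCondensation-sig → stub_dyadicPhaseLocking-sig → <body of CellCondensationGrowing>` — the
conclusion is the crux body VERBATIM (definitionally the route decl; it is written out only so that the
skeleton audit sees exactly one theorem, `CellCondensationGrowing_of` below, concluding the crux by name).
`K₀ := max K₀ K₁`, `c := p · c(2·max K₀ K₁)`, `ρ₀ := min ρ₀ ρ₁`, `δ := min δ_base δ_step`; for a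
`δ`-near-minimiser and `K ∈ [K₀, log N]` run `dyadic_chain` with `Kmax := log N` on the predicate
"every interior cell of side `K(ρa)^(-1/2)` has flat-mode occupation `≥ f·ρℓ³`". [folklore] -/
theorem cellCondensationGrowing_of_hyps :
    (∀ v : ℝ → ENNReal, Literature.MathematicalPhysics.QuantumManyBody.BoseGas.IsRepulsiveFiniteRange v → ∃ K₀ : ℝ, 0 < K₀ ∧ ∀ K₂ : ℝ, K₀ ≤ K₂ → ∃ c ρ₀ : ℝ, 0 < c ∧ 0 < ρ₀ ∧ ∀ ρ : ℝ, 0 < ρ → ρ < ρ₀ → ∀ᶠ N : ℕ in Filter.atTop, let a : ℝ := (Literature.MathematicalPhysics.QuantumManyBody.BoseGas.scatteringLength v).toReal; let L : ℝ := Literature.MathematicalPhysics.QuantumManyBody.BoseGas.sideLength ρ N; ∃ δ : ENNReal, 0 < δ ∧ ∀ Ψ : Literature.MathematicalPhysics.QuantumManyBody.BoseGas.TrialState N L, Literature.MathematicalPhysics.QuantumManyBody.BoseGas.energy v Ψ ≤ Literature.MathematicalPhysics.QuantumManyBody.BoseGas.groundStateEnergy v N L + δ → ∀ K : ℝ, K₀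 ≤ K → K ≤ K₂ → let ℓ : ℝ := K * (ρ * a) ^ (-(1 / 2 : ℝ)); ∀ x₀ : EuclideanSpace ℝ (Fin 3), (∀ k, ℓ ≤ x₀ k ∧ x₀ k + 2 * ℓ ≤ L) → ENNReal.ofReal (c * ρ * ℓ ^ 3) ≤ Literature.MathematicalPhysics.QuantumManyBody.BoseGas.occupation N ({x : EuclideanSpace ℝ (Fin 3) | ∀ k, x k ∈ Set.Ico (x₀ k) (x₀ k + ℓ)}.indicator fun _ => ((Real.sqrt (ℓ ^ 3))⁻¹ : ℂ)) Ψ.ψ) →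
    (∀ v : ℝ → ENNReal, Literature.MathematicalPhysics.QuantumManyBody.BoseGas.IsRepulsiveFiniteRange v → ∃ K₁ ρ₁ p : ℝ, 0 < K₁ ∧ 0 < ρ₁ ∧ 0 < p ∧ ∀ ρ : ℝ, 0 < ρ → ρ < ρ₁ → ∃ η : ℝ → ℝ, (∀ K : ℝ, K₁ ≤ K → 0 ≤ η K) ∧ (∀ K : ℝ, K₁ ≤ K → ∀ n : ℕ, p ≤ (Finset.range n).prod (fun i => η (2 ^ i * K))) ∧ ∀ᶠ N : ℕ in Filter.atTop, let a : ℝ := (Literature.MathematicalPhysics.QuantumManyBody.BoseGas.scatteringLength v).toReal; let L : ℝ := Literature.MathematicalPhysics.QuantumManyBody.BoseGas.sideLength ρ N; ∃ δ : ENNReal, 0 < δ ∧ ∀ Ψ : Literature.MathematicalPhysics.QuantumManyBody.BoseGas.TrialState N L, Literature.MathematicalPhysics.QuantumManyBody.BoseGas.energy v Ψ ≤ Literature.MathematicalPhysics.QuantumManyBody.BoseGas.groundStateEnergy v N L + δ → ∀ K : ℝ, K₁ ≤ K → 2 * K ≤ Real.log N → let ℓ : ℝ := K * (ρ * a) ^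 (-(1 / 2 : ℝ)); let ℓ' : ℝ := 2 * K * (ρ * a) ^ (-(1 / 2 : ℝ)); ∀ f : ℝ, 0 ≤ f → (∀ x₀ : EuclideanSpace ℝ (Fin 3), (∀ k, ℓ ≤ x₀ k ∧ x₀ k + 2 * ℓ ≤ L) → ENNReal.ofReal (f * ρ * ℓ ^ 3) ≤ Literature.MathematicalPhysics.QuantumManyBody.BoseGas.occupation N ({x : EuclideanSpace ℝ (Fin 3) | ∀ k, x k ∈ Set.Ico (x₀ k) (x₀ k + ℓ)}.indicator fun _ => ((Real.sqrt (ℓ ^ 3))⁻¹ : ℂ)) Ψ.ψ) → ∀ x₀ : EuclideanSpace ℝ (Fin 3), (∀ k, ℓ' ≤ x₀ k ∧ x₀ k + 2 * ℓ' ≤ L) → ENNReal.ofReal (η K * f * ρ * ℓ' ^ 3) ≤ Literature.MathematicalPhysics.QuantumManyBody.BoseGas.occupation N ({x : EuclideanSpace ℝ (Fin 3) | ∀ k, x k ∈ Set.Ico (x₀ k) (x₀ k + ℓ')}.indicator fun _ => ((Real.sqrt (ℓ' ^ 3))⁻¹ : ℂ)) Ψ.ψ) →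
    ∀ v : ℝ → ENNReal, Literature.MathematicalPhysics.QuantumManyBody.BoseGas.IsRepulsiveFiniteRange v → ∃ K₀ c ρ₀ : ℝ, 0 < c ∧ 0 < ρ₀ ∧ ∀ ρ : ℝ, 0 < ρ → ρ < ρ₀ → ∀ᶠ N : ℕ in Filter.atTop, let a : ℝ := (Literature.MathematicalPhysics.QuantumManyBody.BoseGas.scatteringLength v).toReal; let L : ℝ := Literature.MathematicalPhysics.QuantumManyBody.BoseGas.sideLength ρ N; ∃ δ : ENNReal, 0 < δ ∧ ∀ Ψ : Literature.MathematicalPhysics.QuantumManyBody.BoseGas.TrialState N L, Literature.MathematicalPhysics.QuantumManyBody.BoseGas.energy v Ψ ≤ Literature.MathematicalPhysics.QuantumManyBody.BoseGas.groundStateEnergy v N L + δ → ∀ K : ℝ, K₀ ≤ K → K ≤ Real.log N → let ℓ : ℝ := K * (ρ * a) ^ (-(1 / 2 : ℝ)); ∀ x₀ : EuclideanSpace ℝ (Fin 3), (∀ k, ℓ ≤ x₀ k ∧ x₀ k + 2 * ℓ ≤ L) → ENNReal.ofReal (c * ρ * ℓ ^ 3) ≤ Literature.MathematicalPhysics.QuantumManyBody.BoseGas.occupation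 N ({x : EuclideanSpace ℝ (Fin 3) | ∀ k, x k ∈ Set.Ico (x₀ k) (x₀ k + ℓ)}.indicator fun _ => ((Real.sqrt (ℓ ^ 3))⁻¹ : ℂ)) Ψ.ψ := by
  intro hB hS v hv
  obtain ⟨K₀, hK₀, hbase⟩ := hB v hv
  obtain ⟨K₁, ρ₁, p, hK₁, hρ₁, hp, hstep⟩ := hS v hv
  -- the common threshold scale and the base window [K₀, 2 Ks]
  set Ks : ℝ := max K₀ K₁ with hKs
  have hKs0 : K₀ ≤ Ks := le_max_left _ _
  have hKs1 : K₁ ≤ Ks := le_max_right _ _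
  have hKspos : 0 < Ks := hK₀.trans_le hKs0
  obtain ⟨c, ρ₀, hc, hρ₀, hbase'⟩ := hbase (2 * Ks) (by linarith)
  refine ⟨Ks, p * c, min ρ₀ ρ₁, mul_pos hp hc, lt_min hρ₀ hρ₁, fun ρ hρ hρlt => ?_⟩
  have hB' := hbase' ρ hρ (hρlt.trans_le (min_le_left _ _))
  obtain ⟨η, hη, hprod, hS'⟩ := hstep ρ hρ (hρlt.trans_le (min_le_right _ _))
  filter_upwards [hB', hS'] with N hbN hsN
  obtain ⟨δb, hδb, HΨb⟩ := hbN
  obtain ⟨δs, hδs, HΨs⟩ := hsN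
  refine ⟨min δb δs, lt_min hδb hδs, fun Ψ hΨ K hK hKlog => ?_⟩
  have hΨb : Literature.MathematicalPhysics.QuantumManyBody.BoseGas.energy v Ψ ≤ Literature.MathematicalPhysics.QuantumManyBody.BoseGas.groundStateEnergy v N (Literature.MathematicalPhysics.QuantumManyBody.BoseGas.sideLength ρ N) + δb :=
    hΨ.trans (add_le_add le_rfl (min_le_left _ _))
  have hΨs : Literature.MathematicalPhysics.QuantumManyBody.BoseGas.energy v Ψ ≤ Literature.MathematicalPhysics.QuantumManyBody.BoseGas.groundStateEnergy v N (Literature.MathematicalPhysics.QuantumManyBody.BoseGas.sideLength ρ N) + δs :=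
    hΨ.trans (add_le_add le_rfl (min_le_right _ _))
  have hsnn : 0 ≤ (ρ * (Literature.MathematicalPhysics.QuantumManyBody.BoseGas.scatteringLength v).toReal) ^ (-(1 / 2 : ℝ)) :=
    Real.rpow_nonneg (mul_nonneg hρ.le ENNReal.toReal_nonneg) _
  -- the dyadic chain on P K f := "every interior K-cell has flat-mode occupation ≥ f ρ ℓ³"
  have key := dyadic_chain
    (P := fun K f => ∀ x₀ : EuclideanSpace ℝ (Fin 3),
      (∀ k, K * (ρ * (Literature.MathematicalPhysics.QuantumManyBody.BoseGas.scatteringLength v).toReal) ^ (-(1 / 2 : ℝ)) ≤ x₀ k ∧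
        x₀ k + 2 * (K * (ρ * (Literature.MathematicalPhysics.QuantumManyBody.BoseGas.scatteringLength v).toReal) ^ (-(1 / 2 : ℝ))) ≤ Literature.MathematicalPhysics.QuantumManyBody.BoseGas.sideLength ρ N) →
      ENNReal.ofReal (f * ρ * (K * (ρ * (Literature.MathematicalPhysics.QuantumManyBody.BoseGas.scatteringLength v).toReal) ^ (-(1 / 2 : ℝ))) ^ 3) ≤
        Literature.MathematicalPhysics.QuantumManyBody.BoseGas.occupation N
          ({x : EuclideanSpace ℝ (Fin 3) | ∀ k, x k ∈ Set.Ico (x₀ k)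
              (x₀ k + K * (ρ * (Literature.MathematicalPhysics.QuantumManyBody.BoseGas.scatteringLength v).toReal) ^ (-(1 / 2 : ℝ)))}.indicator
            fun _ => ((Real.sqrt ((K * (ρ * (Literature.MathematicalPhysics.QuantumManyBody.BoseGas.scatteringLength v).toReal) ^ (-(1 / 2 : ℝ))) ^ 3))⁻¹ : ℂ))
          Ψ.ψ)
    (K₀ := Ks) (Kmax := Real.log N) (c := c) (p := p) (η := η) hKspos hc.le
    (fun K f g hKK hfg hg x₀ hx₀ => (ENNReal.ofReal_le_ofReal (mul_le_mul_of_nonneg_right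
      (mul_le_mul_of_nonneg_right hfg hρ.le) (pow_nonneg (mul_nonneg (hKspos.le.trans hKK) hsnn) 3))).trans
      (hg x₀ hx₀))
    (fun K hK1 hK2 => HΨb Ψ hΨb K (hKs0.trans hK1) hK2)
    (fun K f hK1 hK2 hf hPK => HΨs Ψ hΨs K (hKs1.trans hK1) hK2 f hf hPK)
    (fun K hK1 => hη K (hKs1.trans hK1))
    (fun K hK1 n => hprod K (hKs1.trans hK1) n)
  exact key K hK hKlog

/-- THE SKELETON THEOREM: the two declared stubs imply the crux
`BECStoquasticCensoring.CellCondensationGrowing` BY NAME (its only `sorry`s are the two stubs'; the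
composition `cellCondensationGrowing_of_hyps` is kernel-checked and sorry-free). [folklore] -/
theorem CellCondensationGrowing_of : Summit.AtomisticToContinuum.BoseEinsteinCondensation.Theses.BECStoquasticCensoring.CellCondensationGrowing :=
  cellCondensationGrowing_of_hyps stub_baseWindowCondensation stub_dyadicPhaseLocking

end Summit.AtomisticToContinuum.BoseEinsteinCondensation.Cruxes.CellCondensationGrowing.Birth
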